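import Literature.Analysis.Calculus.WhitneyConvexOperator
import Literature.Analysis.Calculus.WhitneyConvexGluing
import Mathlib.Analysis.Calculus.SmoothSeries
import HarnessLib

/-!
# The `C^∞` extension from a compact convex body

Support file 7/7 for the proof of `Literature.Analysis.Calculus.WhitneyExtensionConvex`
(`WhitneyExtension.lean`; Whitney (1934), Thm. I, on closed convex sets with nonempty
interior): for a compact convex body `K ⊇ closedBall c r` of a finite-dimensional real normed
space and `f` of class `C^∞` on `K` (within), there is a `C^∞` function on the whole space
equal to `f` on `K` (`Literature.Analysis.Calculus.WhitneyConvex.exists_contDiff_extension`).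
Steps:

* `contDiff_extOp`, `iteratedFDeriv_extOp_eq_jet` — the extension of order `n`
  (`WhitneyConvexOperator.lean`) is of class `Cⁿ` with the jet of `f` on `K`, by the gluing
  theorem (`WhitneyConvexGluing.lean`) fed with the key estimate
  `norm_iteratedFDeriv_extOp_sub_le` (Whitney (1934), §11: the case `m` finite);
* `norm_iteratedFDeriv_le_of_flat` — **flat functions decay**: a `Cⁿ` function whose `n`-jet
  vanishes on the compact `K` has `‖Dᵝ h (x)‖ ≤ η d(x)ⁿ⁻ᵝ` near `K` for any `η > 0` (mean value
  inequality along the segment to a nearest point, downward induction on `β`);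
* `nearCut K δ` — smooth cutoffs equal to `1` near `K` and to `0` where `d ≥ 2δ`, with
  `‖Dⁱ (nearCut K δ)‖ ≤ C_i / δⁱ` (regularized distance, as for the layers);
* `exists_contDiff_extension` — **the case `m` infinite** (Whitney (1934), §12, in the
  telescoping form): with `g_n` the extension of order `n` and `h_n = g_{n+1} - g_n` (of class
  `Cⁿ`, `n`-flat on `K`), the function `g_0 + ∑_n χ_n h_n`, with cutoffs `χ_n = nearCut K δ_n`
  at scales `δ_n → 0` chosen so that `‖Dᵝ (χ_n h_n)‖ ≤ 2⁻ⁿ` for `β ≤ n`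
  (`exists_cutoff_scale`), is `C^M` for every `M` — it equals `g_M` plus a function vanishing
  near `K` and smooth off `K`, plus a series which is `C^M` by Mathlib's `contDiff_tsum` — and
  equals `f` on `K`.

## References

* H. Whitney, *Analytic extensions of differentiable functions defined in closed sets*, Trans.
  Amer. Math. Soc. 36 (1934), 63–89, §§11–12 (Lemma 2). [Whitney1934]
-/

open Set Metric Filter Function Finset
open scoped ContDiff Topology Nat

noncomputable section

namespace Literature.Analysis.Calculus.WhitneyConvex

variable {E : Type*} [NormedAddCommGroup E] [NormedSpace ℝ E] [FiniteDimensional ℝ E]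
  [MeasurableSpace E] [BorelSpace E]
variable {F : Type*} [NormedAddCommGroup F] [NormedSpace ℝ F]

/-! ### The extension of order `n` is of class `Cⁿ` -/

section Order

variable {f : E → F} {K : Set E} {c : E} {r : ℝ} {n : ℕ}
variable (hK : Convex ℝ K) (hKc : IsCompact K) (hball : closedBall c r ⊆ K) (hr : 0 < r)
  (hf : ContDiffOn ℝ ∞ f K)
include hK hKc hball hr hf

/-- The limit hypothesis of the gluing theorem for the extension of order `n`: at every point
of `K` the derivatives of orders `≤ n` of `extOp` tend from outside to the within-derivatives
of `f` (the key estimate `norm_iteratedFDeriv_extOp_sub_le`). [folklore] -/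
theorem tendsto_iteratedFDeriv_extOp {m : ℕ} (hm : m ≤ n) {x : E} (hx : x ∈ K) :
    Tendsto (iteratedFDeriv ℝ m (extOp f K c r n)) (𝓝[Kᶜ] x)
      (𝓝 (iteratedFDerivWithin ℝ m f K x)) := by
  have hne : K.Nonempty := ⟨x, hx⟩
  refine Metric.tendsto_nhdsWithin_nhds.2 fun ε hε => ?_
  obtain ⟨δ, hδ, h⟩ := norm_iteratedFDeriv_extOp_sub_le hK hKc hball hr hf m hm (half_pos hε)
  refine ⟨δ, hδ, fun y hy hyx => ?_⟩
  have hyK : y ∉ K := hy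
  have hypos : 0 < infDist y K := (hKc.isClosed.notMem_iff_infDist_pos hne).1 hyK
  have hyd : infDist y K < δ := (infDist_le_dist_of_mem hx).trans_lt hyx
  rw [dist_eq_norm]
  rw [dist_eq_norm] at hyx
  exact (h y hypos hyd x hx hyx).trans_lt (half_lt_self hε)

omit [NormedSpace ℝ E] [FiniteDimensional ℝ E] [MeasurableSpace E] [BorelSpace E] hK hf in
/-- `Kᶜ = {d > 0}` for our (closed, nonempty) `K`. [folklore] -/
theorem compl_eq_offSet : Kᶜ = offSet K :=
  (offSet_eq_compl hKc.isClosed ⟨c, hball (mem_closedBall_self hr.le)⟩).symm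

/-- **The extension of order `n` is of class `Cⁿ`.** [cite: Whitney1934, §11 Lemma 2 (m finite)] -/
theorem contDiff_extOp : ContDiff ℝ n (extOp f K c r n) := by
  have hne : K.Nonempty := ⟨c, hball (mem_closedBall_self hr.le)⟩
  have hKu : UniqueDiffOn ℝ K :=
    uniqueDiffOn_convex hK ⟨c, interior_mono hball (by
      rw [interior_closedBall c hr.ne']; exact mem_ball_self hr)⟩
  have hg : ContDiffOn ℝ n (extOp f K c r n) Kᶜ := by
    rw [compl_eq_offSet hKc hball hr]
    exact (contDiffOn_extOp hK hKc hball hr hf).of_le (by exact_mod_cast le_top)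
  exact contDiff_of_tendsto_iteratedFDeriv hKc.isClosed hKu (hf.of_le (by exact_mod_cast le_top))
    hg extOp_eqOn fun m hm x hx => tendsto_iteratedFDeriv_extOp hK hKc hball hr hf hm hx

/-- … **with the jet of `f` on `K`**: `Dᵝ (extOp f K c r n) = Dᵝ_K f` on `K` for `β ≤ n`.
[cite: Whitney1934, §11 Lemma 2 (m finite)] -/
theorem iteratedFDeriv_extOp_eq_jet {β : ℕ} (hβ : β ≤ n) {x : E} (hx : x ∈ K) :
    iteratedFDeriv ℝ β (extOp f K c r n) x = iteratedFDerivWithin ℝ β f K x := by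
  have hKu : UniqueDiffOn ℝ K :=
    uniqueDiffOn_convex hK ⟨c, interior_mono hball (by
      rw [interior_closedBall c hr.ne']; exact mem_ball_self hr)⟩
  have hg : ContDiffOn ℝ n (extOp f K c r n) Kᶜ := by
    rw [compl_eq_offSet hKc hball hr]
    exact (contDiffOn_extOp hK hKc hball hr hf).of_le (by exact_mod_cast le_top)
  exact iteratedFDeriv_eq_of_tendsto_iteratedFDeriv hKc.isClosed hKu
    (hf.of_le (by exact_mod_cast le_top)) hg extOp_eqOn
    (fun m hm x hx => tendsto_iteratedFDeriv_extOp hK hKc hball hr hf hm hx) hβ hx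

/-- The extension of order `n` is `C^∞` on `Kᶜ`. [folklore] -/
theorem contDiffOn_extOp_compl : ContDiffOn ℝ ∞ (extOp f K c r n) Kᶜ := by
  rw [compl_eq_offSet hKc hball hr]
  exact contDiffOn_extOp hK hKc hball hr hf

end Order

/-! ### Flat functions decay near `K` -/

section Flat

omit [FiniteDimensional ℝ E] [MeasurableSpace E] [BorelSpace E]
variable [ProperSpace E]

/-- **Flat functions decay.**  Let `h` be of class `Cⁿ` on `E` with `Dᵝ h = 0` on the compact
set `K` for all `β ≤ n`.  Then for every `β ≤ n` and `η > 0` there is `δ > 0` with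
`‖Dᵝ h (x)‖ ≤ η d(x)ⁿ⁻ᵝ` whenever `d(x) < δ` (`d = infDist · K`): the case `β = n` is the uniform
continuity of `Dⁿ h` near `K`; for `β < n`, the mean value inequality along the segment from
`x` to a nearest point of `K` (on which `d ≤ d(x)`) and the case `β + 1`. [folklore] -/
theorem norm_iteratedFDeriv_le_of_flat {K : Set E} (hKc : IsCompact K) (hne : K.Nonempty)
    {h : E → F} {n : ℕ} (hh : ContDiff ℝ n h)
    (hflat : ∀ β, β ≤ n → ∀ x ∈ K, iteratedFDeriv ℝ β h x = 0) :
    ∀ β, β ≤ n → ∀ η : ℝ, 0 < η → ∃ δ : ℝ, 0 < δ ∧ ∀ x : E, infDist x K < δ →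
      ‖iteratedFDeriv ℝ β h x‖ ≤ η * infDist x K ^ (n - β) := by
  -- downward induction: `P (n - j)` for `j ≤ n`
  suffices H : ∀ j, j ≤ n → ∀ η : ℝ, 0 < η → ∃ δ : ℝ, 0 < δ ∧ ∀ x : E, infDist x K < δ →
      ‖iteratedFDeriv ℝ (n - j) h x‖ ≤ η * infDist x K ^ j by
    intro β hβ η hη
    obtain ⟨δ, hδ, hδ'⟩ := H (n - β) (Nat.sub_le n β) η hη
    refine ⟨δ, hδ, fun x hx => ?_⟩
    have := hδ' x hx
    rwa [Nat.sub_sub_self hβ] at this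
  intro j
  induction j with
  | zero =>
    intro _ η hη
    -- uniform continuity of `Dⁿ h` on the compact `1`-thickening of `K`
    have hcont : Continuous (iteratedFDeriv ℝ n h) := hh.continuous_iteratedFDeriv le_rfl
    have hT : IsCompact (cthickening 1 K) := hKc.cthickening
    obtain ⟨δ₀, hδ₀, hUC⟩ := Metric.uniformContinuousOn_iff.1
      (hT.uniformContinuousOn_of_continuous hcont.continuousOn) η hη
    refine ⟨min δ₀ 1, by positivity, fun x hx => ?_⟩
    obtain ⟨b, hb, hbd⟩ := hKc.exists_infDist_eq_dist hne x
    have hx1 : x ∈ cthickening 1 K := mem_cthickening_of_dist_le x b 1 K hb (by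
      rw [← hbd]; exact (hx.trans_le (min_le_right _ _)).le)
    have hb1 : b ∈ cthickening 1 K := self_subset_cthickening K hb
    have hxb : dist x b < δ₀ := by rw [← hbd]; exact hx.trans_le (min_le_left _ _)
    have h1 := hUC x hx1 b hb1 hxb
    rw [hflat n le_rfl b hb, dist_zero_right] at h1
    rw [Nat.sub_zero, pow_zero, mul_one]
    exact h1.le
  | succ j ih =>
    intro hj η hη
    obtain ⟨δ, hδ, hδ'⟩ := ih (Nat.le_of_succ_le hj) η hη
    refine ⟨δ, hδ, fun x hx => ?_⟩
    obtain ⟨b, hb, hbd⟩ := hKc.exists_infDist_eq_dist hne x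
    set β : ℕ := n - (j + 1) with hβ
    have hβ1 : β + 1 = n - j := by omega
    have hβn : (β : ℕ∞ω) < n := by exact_mod_cast (show β < n by omega)
    -- the derivative of `Dᵝ h` along the segment `[b, x]`
    have hdiff : ∀ z, HasFDerivAt (iteratedFDeriv ℝ β h) (fderiv ℝ (iteratedFDeriv ℝ β h) z) z :=
      fun z => ((hh.differentiable_iteratedFDeriv hβn) z).hasFDerivAt
    have hbound : ∀ z ∈ segment ℝ b x, ‖fderiv ℝ (iteratedFDeriv ℝ β h) z‖ ≤ η * infDist x K ^ j := by
      intro z hz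
      rw [norm_fderiv_iteratedFDeriv, hβ1]
      -- `d(z) ≤ d(x) < δ`
      have hzx : infDist z K ≤ infDist x K := by
        obtain ⟨a₁, a₂, ha₁, ha₂, hab, rfl⟩ := hz
        calc infDist (a₁ • b + a₂ • x) K ≤ dist (a₁ • b + a₂ • x) b := infDist_le_dist_of_mem hb
          _ = ‖a₂ • (x - b)‖ := by
              rw [dist_eq_norm]
              congr 1
              rw [show a₁ = 1 - a₂ by linarith]
              simp only [sub_smul, one_smul, smul_sub]
              abel
          _ = a₂ * dist x b := by rw [norm_smul, Real.norm_of_nonneg ha₂, dist_eq_norm]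
          _ ≤ 1 * dist x b := mul_le_mul_of_nonneg_right (by linarith) dist_nonneg
          _ = infDist x K := by rw [one_mul, hbd]
      refine (hδ' z (hzx.trans_lt hx)).trans ?_
      exact mul_le_mul_of_nonneg_left (pow_le_pow_left₀ infDist_nonneg hzx j) hη.le
    have hmv := (convex_segment b x).norm_image_sub_le_of_norm_hasFDerivWithin_le
      (fun z _ => (hdiff z).hasFDerivWithinAt) hbound (left_mem_segment ℝ b x)
      (right_mem_segment ℝ b x)
    rw [hflat β (by omega) b hb, sub_zero] at hmv
    calc ‖iteratedFDeriv ℝ β h x‖ ≤ η * infDist x K ^ j * ‖x - b‖ := hmv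
      _ = η * infDist x K ^ (j + 1) := by
          rw [← dist_eq_norm, ← hbd, pow_succ]; ring

end Flat

/-! ### Cutoffs near `K` -/

section Cutoff

/-- The derivatives of the cutoff `χ` are bounded (it is constant off `[1, 2]`). [folklore] -/
theorem exists_bound_iteratedFDeriv_dyadicCutoff (i : ℕ) :
    ∃ C : ℝ, 0 ≤ C ∧ ∀ s, ‖iteratedFDeriv ℝ i dyadicCutoff s‖ ≤ C := by
  have hcd : ContDiff ℝ ∞ dyadicCutoff := contDiff_dyadicCutoff
  have hc : Continuous fun s => ‖iteratedFDeriv ℝ i dyadicCutoff s‖ :=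
    (hcd.continuous_iteratedFDeriv (by exact_mod_cast le_top)).norm
  obtain ⟨C, hC⟩ := (isCompact_Icc (a := (1 / 2 : ℝ)) (b := 4)).exists_bound_of_continuousOn
    hc.continuousOn
  refine ⟨max C 1, le_max_of_le_right zero_le_one, fun s => ?_⟩
  by_cases hs : s ∈ Set.Icc (1 / 2 : ℝ) 4
  · have h1 := hC s hs
    rw [Real.norm_of_nonneg (norm_nonneg _)] at h1
    exact h1.trans (le_max_left _ _)
  · have hconst : ∃ a : ℝ, dyadicCutoff =ᶠ[𝓝 s] fun _ => a := by
      rcases not_and_or.1 hs with h | h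
      · refine ⟨1, ?_⟩
        filter_upwards [Iio_mem_nhds (show s < 1 by linarith [lt_of_not_ge h])] with y hy
        exact dyadicCutoff_of_le_one (le_of_lt hy)
      · refine ⟨0, ?_⟩
        filter_upwards [Ioi_mem_nhds (show 2 < s by linarith [lt_of_not_ge h])] with y hy
        exact dyadicCutoff_of_two_le (le_of_lt hy)
    obtain ⟨a, ha⟩ := hconst
    rw [(ha.iteratedFDeriv ℝ i).eq_of_nhds]
    rcases i with _ | i
    · rw [norm_iteratedFDeriv_zero, show a = dyadicCutoff s from (ha.eq_of_nhds).symm,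
        Real.norm_eq_abs, abs_of_nonneg (dyadicCutoff_nonneg _)]
      exact (dyadicCutoff_le_one _).trans (le_max_right _ _)
    · rw [iteratedFDeriv_const_of_ne (by omega), Pi.zero_apply, norm_zero]
      exact le_trans zero_le_one (le_max_right _ _)

/-- A bound for all derivatives of `χ` of order `≤ i`. [folklore] -/
def dyadicCutoffBound (i : ℕ) : ℝ :=
  ∑ l ∈ range (i + 1), Classical.choose (exists_bound_iteratedFDeriv_dyadicCutoff l)

/-- The bounds are nonnegative. [folklore] -/
theorem dyadicCutoffBound_nonneg (i : ℕ) : 0 ≤ dyadicCutoffBound i :=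
  sum_nonneg fun l _ => (Classical.choose_spec (exists_bound_iteratedFDeriv_dyadicCutoff l)).1

/-- `‖Dˡ χ‖ ≤ dyadicCutoffBound i` for `l ≤ i`. [folklore] -/
theorem norm_iteratedFDeriv_dyadicCutoff_le {l i : ℕ} (hl : l ≤ i) (s : ℝ) :
    ‖iteratedFDeriv ℝ l dyadicCutoff s‖ ≤ dyadicCutoffBound i :=
  ((Classical.choose_spec (exists_bound_iteratedFDeriv_dyadicCutoff l)).2 s).trans
    (single_le_sum (f := fun l => Classical.choose (exists_bound_iteratedFDeriv_dyadicCutoff l))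
      (fun l _ => (Classical.choose_spec (exists_bound_iteratedFDeriv_dyadicCutoff l)).1)
      (mem_range.2 (Nat.lt_succ_of_le hl)))

open scoped Classical in
/-- **The cutoff near `K` at scale `δ`**: `χ(Δ/δ)` off `K` (`Δ` the regularized distance),
`1` on `{d = 0}`. [folklore] -/
def nearCut (K : Set E) (δ : ℝ) (x : E) : ℝ :=
  if 0 < infDist x K then dyadicCutoff ((1 / δ) * regDist K x) else 1

/-- Off `K` the cutoff is `χ ∘ ((1/δ) Δ)`. [folklore] -/
theorem nearCut_of_pos {K : Set E} (δ : ℝ) {x : E} (hx : 0 < infDist x K) :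
    nearCut K δ x = dyadicCutoff ((1 / δ) * regDist K x) := by
  unfold nearCut; rw [if_pos hx]

/-- The cutoff is `1` where `d < δ/16` (there `Δ ≤ 8 d < δ/2`). [folklore] -/
theorem nearCut_eq_one {K : Set E} {δ : ℝ} (hδ : 0 < δ) {x : E} (hx : infDist x K < δ / 16) :
    nearCut K δ x = 1 := by
  unfold nearCut
  split_ifs with h
  · refine dyadicCutoff_of_le_one ?_
    have h8 := regDist_le h
    rw [one_div_mul_eq_div, div_le_one hδ]
    linarith
  · rfl

/-- The cutoff vanishes where `d ≥ 2δ` (there `Δ ≥ d ≥ 2δ`). [folklore] -/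
theorem nearCut_eq_zero {K : Set E} {δ : ℝ} (hδ : 0 < δ) {x : E} (hx : 2 * δ ≤ infDist x K) :
    nearCut K δ x = 0 := by
  have hpos : 0 < infDist x K := lt_of_lt_of_le (by positivity) hx
  rw [nearCut_of_pos δ hpos]
  refine dyadicCutoff_of_two_le ?_
  have := infDist_le_regDist hpos
  rw [one_div_mul_eq_div, le_div_iff₀ hδ]
  linarith

/-- `0 ≤ nearCut ≤ 1`. [folklore] -/
theorem nearCut_mem_Icc (K : Set E) (δ : ℝ) (x : E) : nearCut K δ x ∈ Set.Icc (0 : ℝ) 1 := by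
  unfold nearCut
  split_ifs
  · exact ⟨dyadicCutoff_nonneg _, dyadicCutoff_le_one _⟩
  · exact ⟨zero_le_one, le_rfl⟩

/-- The cutoff is smooth off `K`. [folklore] -/
theorem contDiffOn_nearCut (K : Set E) (δ : ℝ) : ContDiffOn ℝ ∞ (nearCut K δ) (offSet K) := by
  have h : ContDiffOn ℝ ∞ (fun x => dyadicCutoff ((1 / δ) * regDist K x)) (offSet K) :=
    contDiff_dyadicCutoff.comp_contDiffOn (contDiffOn_const.mul (contDiffOn_regDist K))
  exact h.congr fun x hx => nearCut_of_pos δ hx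

/-- **The cutoff is smooth on the whole space** (for `δ > 0`): off `K` it is a smooth function
of the regularized distance, and on the open set `{d < δ/16} ⊇ {d = 0}` it is constant. [folklore] -/
theorem contDiff_nearCut (K : Set E) {δ : ℝ} (hδ : 0 < δ) : ContDiff ℝ ∞ (nearCut K δ) := by
  refine contDiff_iff_contDiffAt.2 fun x => ?_
  by_cases hx : infDist x K < δ / 16
  · have hev : nearCut K δ =ᶠ[𝓝 x] fun _ => (1 : ℝ) := by
      filter_upwards [(continuous_infDist_pt K).continuousAt.eventually (gt_mem_nhds hx)] with y hy
      exact nearCut_eq_one hδ hy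
    exact (contDiffAt_const (c := (1 : ℝ))).congr_of_eventuallyEq hev
  · have hpos : 0 < infDist x K := lt_of_lt_of_le (by positivity) (not_lt.1 hx)
    exact (contDiffOn_nearCut K δ).contDiffAt ((isOpen_offSet K).mem_nhds hpos)

/-- The constant `C_i` of the cutoff bounds (depends on `E` and `i`). [folklore] -/
def nearCutBound (E : Type*) [NormedAddCommGroup E] [NormedSpace ℝ E] [FiniteDimensional ℝ E]
    [MeasurableSpace E] [BorelSpace E] (i : ℕ) : ℝ :=
  max 1 (i ! * dyadicCutoffBound i * (8 * rdConstMax E i) ^ i)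

/-- `1 ≤ C_i`. [folklore] -/
theorem one_le_nearCutBound (i : ℕ) : 1 ≤ nearCutBound E i := le_max_left _ _

/-- **Derivative bounds for the cutoffs**: `‖Dⁱ (nearCut K δ) (x)‖ ≤ C_i / δⁱ` for `0 < δ ≤ 1`,
at every point.  Where `(1/δ) Δ ∉ [1, 2]` the cutoff is locally constant; elsewhere
`d ≥ Δ/8 ≥ δ/8`, so `‖Dˡ ((1/δ) Δ)‖ ≤ (1/δ) R_l d^{1-l} ≤ (8 R*/δ)ˡ`, and the bound for the
derivatives of a composition applies. [folklore] -/
theorem norm_iteratedFDeriv_nearCut_le (K : Set E) {δ : ℝ} (hδ : 0 < δ) (hδ1 : δ ≤ 1) (i : ℕ) (x : E) :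
    ‖iteratedFDeriv ℝ i (nearCut K δ) x‖ ≤ nearCutBound E i / δ ^ i := by
  have hδi : 0 < δ ^ i := pow_pos hδ i
  have hδi1 : δ ^ i ≤ 1 := pow_le_one₀ hδ.le hδ1
  have hR1 : 1 ≤ rdConstMax E i := one_le_rdConstMax i
  -- a locally constant cutoff has small derivatives
  have hconst : ∀ a : ℝ, a ∈ Set.Icc (0 : ℝ) 1 → (nearCut K δ =ᶠ[𝓝 x] fun _ => a) →
      ‖iteratedFDeriv ℝ i (nearCut K δ) x‖ ≤ nearCutBound E i / δ ^ i := by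
    intro a ha hev
    rw [(hev.iteratedFDeriv ℝ i).eq_of_nhds]
    have h1 : (1 : ℝ) ≤ nearCutBound E i / δ ^ i := by
      rw [le_div_iff₀ hδi]
      calc 1 * δ ^ i ≤ 1 * 1 := by gcongr
        _ ≤ nearCutBound E i := by rw [one_mul]; exact one_le_nearCutBound i
    rcases i with _ | i
    · rw [norm_iteratedFDeriv_zero, Real.norm_eq_abs, abs_of_nonneg ha.1]
      exact ha.2.trans h1
    · rw [iteratedFDeriv_const_of_ne (by omega), Pi.zero_apply, norm_zero]
      exact le_trans zero_le_one h1
  by_cases hx : infDist x K < δ / 16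
  · exact hconst 1 ⟨zero_le_one, le_rfl⟩ (by
      filter_upwards [(continuous_infDist_pt K).continuousAt.eventually (gt_mem_nhds hx)] with y hy
      exact nearCut_eq_one hδ hy)
  have hpos : 0 < infDist x K := lt_of_lt_of_le (by positivity) (not_lt.1 hx)
  have hU : IsOpen (offSet K) := isOpen_offSet K
  have hc : ContinuousAt (fun y => (1 / δ) * regDist K y) x :=
    continuousAt_const.mul (continuousAt_regDist hpos)
  have hevpos : ∀ᶠ y in 𝓝 x, 0 < infDist y K := hU.mem_nhds hpos
  by_cases hact : 1 ≤ (1 / δ) * regDist K x ∧ (1 / δ) * regDist K x ≤ 2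
  swap
  · -- locally constant off the transition region
    rcases not_and_or.1 hact with h | h
    · refine hconst 1 ⟨zero_le_one, le_rfl⟩ ?_
      filter_upwards [hc.eventually (gt_mem_nhds (lt_of_not_ge h)), hevpos] with y hy hy'
      rw [nearCut_of_pos δ hy']
      exact dyadicCutoff_of_le_one hy.le
    · refine hconst 0 ⟨le_rfl, zero_le_one⟩ ?_
      filter_upwards [hc.eventually (lt_mem_nhds (lt_of_not_ge h)), hevpos] with y hy hy'
      rw [nearCut_of_pos δ hy']
      exact dyadicCutoff_of_two_le hy.le
  -- the transition region: `δ ≤ Δ ≤ 2δ`, `d ≥ δ/8`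
  have hΔ : δ ≤ regDist K x := by
    have := hact.1; rwa [one_div_mul_eq_div, le_div_iff₀ hδ, one_mul] at this
  have hd : 1 ≤ 8 / δ * infDist x K := by
    have h8 := regDist_le hpos
    rw [div_mul_eq_mul_div, le_div_iff₀ hδ]
    linarith
  set a : ℝ := 1 / δ with ha
  have ha0 : 0 < a := by positivity
  have hf : ContDiffOn ℝ ∞ (a • regDist K) (offSet K) := contDiffOn_const.smul (contDiffOn_regDist K)
  have hg : ContDiffOn ℝ ∞ dyadicCutoff univ := contDiff_dyadicCutoff.contDiffOn
  have hC : ∀ l, l ≤ i → ‖iteratedFDerivWithin ℝ l dyadicCutoff univ ((a • regDist K) x)‖ ≤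
      dyadicCutoffBound i := fun l hl => by
    rw [iteratedFDerivWithin_univ]; exact norm_iteratedFDeriv_dyadicCutoff_le hl _
  have hD : ∀ l, 1 ≤ l → l ≤ i →
      ‖iteratedFDerivWithin ℝ l (a • regDist K) (offSet K) x‖ ≤ (8 * rdConstMax E i * a) ^ l := by
    intro l hl1 hli
    obtain ⟨l, rfl⟩ : ∃ l', l = l' + 1 := ⟨l - 1, by omega⟩
    rw [iteratedFDerivWithin_const_smul_apply (((contDiffOn_regDist K) x hpos).of_le
      (by exact_mod_cast le_top)) hU.uniqueDiffOn hpos, norm_smul, Real.norm_of_nonneg ha0.le,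
      iteratedFDerivWithin_of_isOpen (l + 1) hU hpos]
    have hb := norm_iteratedFDeriv_regDist_le (K := K) (i := l + 1) hl1 hpos
    simp only [Nat.add_sub_cancel] at hb
    have hdpow : 0 < infDist x K ^ l := pow_pos hpos l
    have hq : rdConst' E (l + 1) / infDist x K ^ l ≤ rdConstMax E i * (8 * a) ^ l := by
      rw [div_le_iff₀ hdpow]
      have h1 : (1 : ℝ) ≤ (8 * a * infDist x K) ^ l := one_le_pow₀ (by
        rw [ha, show 8 * (1 / δ) * infDist x K = 8 / δ * infDist x K by ring]; exact hd)
      calc rdConst' E (l + 1) ≤ rdConstMax E i := rdConst'_le_rdConstMax hli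
        _ ≤ rdConstMax E i * (8 * a * infDist x K) ^ l :=
            le_mul_of_one_le_right (zero_le_one.trans hR1) h1
        _ = rdConstMax E i * (8 * a) ^ l * infDist x K ^ l := by rw [mul_pow]; ring
    calc a * ‖iteratedFDeriv ℝ (l + 1) (regDist K) x‖
        ≤ a * (rdConstMax E i * (8 * a) ^ l) := mul_le_mul_of_nonneg_left (hb.trans hq) ha0.le
      _ = (rdConstMax E i * 8 ^ l) * a ^ (l + 1) := by ring
      _ ≤ (8 ^ (l + 1) * rdConstMax E i ^ (l + 1)) * a ^ (l + 1) := by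
          refine mul_le_mul_of_nonneg_right ?_ (by positivity)
          rw [mul_comm]
          exact mul_le_mul (pow_le_pow_right₀ (by norm_num) (Nat.le_succ l))
            (le_self_pow₀ hR1 (Nat.succ_ne_zero l)) (zero_le_one.trans hR1) (by positivity)
      _ = (8 * rdConstMax E i * a) ^ (l + 1) := by ring
  have key := norm_iteratedFDerivWithin_comp_le (n := i) (N := ∞) hg hf
    (by exact_mod_cast le_top) uniqueDiffOn_univ hU.uniqueDiffOn (mapsTo_univ _ _) hpos hC hD
  -- `nearCut = χ ∘ (a • Δ)` near `x`
  have hev : nearCut K δ =ᶠ[𝓝 x] dyadicCutoff ∘ (a • regDist K) := by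
    filter_upwards [hevpos] with y hy
    rw [nearCut_of_pos δ hy]; rfl
  rw [(hev.iteratedFDeriv ℝ i).eq_of_nhds, ← iteratedFDerivWithin_of_isOpen i hU hpos]
  refine key.trans ?_
  rw [mul_pow, le_div_iff₀ hδi]
  have hai : a ^ i * δ ^ i = 1 := by rw [← mul_pow, ha, one_div_mul_cancel hδ.ne', one_pow]
  calc ↑i ! * dyadicCutoffBound i * ((8 * rdConstMax E i) ^ i * a ^ i) * δ ^ i
      = ↑i ! * dyadicCutoffBound i * (8 * rdConstMax E i) ^ i * (a ^ i * δ ^ i) := by ring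
    _ = ↑i ! * dyadicCutoffBound i * (8 * rdConstMax E i) ^ i := by rw [hai, mul_one]
    _ ≤ nearCutBound E i := le_max_right _ _

end Cutoff

/-! ### The `C^∞` extension -/

section Smooth

omit [FiniteDimensional ℝ E] [MeasurableSpace E] [BorelSpace E] in
/-- Uniformizing finitely many positive thresholds (for conditions monotone in the
threshold). [folklore] -/
theorem exists_forall_le_of_antitone {P : ℕ → ℝ → Prop}
    (hP : ∀ β δ δ', δ' ≤ δ → P β δ → P β δ') {m : ℕ}
    (h : ∀ β, β ≤ m → ∃ δ : ℝ, 0 < δ ∧ P β δ) : ∃ δ : ℝ, 0 < δ ∧ ∀ β, β ≤ m → P β δ := by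
  induction m with
  | zero =>
    obtain ⟨δ, hδ, h0⟩ := h 0 le_rfl
    exact ⟨δ, hδ, fun β hβ => by rw [Nat.le_zero.1 hβ]; exact h0⟩
  | succ m ih =>
    obtain ⟨δ₁, hδ₁, h₁⟩ := ih fun β hβ => h β (Nat.le_succ_of_le hβ)
    obtain ⟨δ₂, hδ₂, h₂⟩ := h (m + 1) le_rfl
    refine ⟨min δ₁ δ₂, by positivity, fun β hβ => ?_⟩
    rcases Nat.of_le_succ hβ with hb | hb
    · exact hP _ _ _ (min_le_left _ _) (h₁ β hb)
    · rw [hb]; exact hP _ _ _ (min_le_right _ _) h₂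

/-- **Cutting off a flat function, small in `Cᵐ`.**  Let `h` be of class `Cᵐ` with vanishing
`m`-jet on the compact nonempty `K`.  For every `ε > 0` (and threshold `δmax > 0`) there is a
scale `0 < δ ≤ min δmax 1` such that all derivatives of orders `≤ m` of `nearCut K δ • h` are
bounded by `ε` everywhere: near `K` the product is `h`, small by flatness; far away it is `0`;
in the transition region `δ/16 ≤ d ≤ 2δ`, the Leibniz bound with `‖Dⁱ nearCut‖ ≤ C_i/δⁱ` and
`‖Dᵝ⁻ⁱ h‖ ≤ η d^{m-β+i} ≤ η (2δ)^{m-β+i}` gives `O(η)`. [folklore] -/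
theorem exists_cutoff_scale {K : Set E} (hKc : IsCompact K) (hne : K.Nonempty) {h : E → F}
    {m : ℕ} (hh : ContDiff ℝ m h) (hflat : ∀ β, β ≤ m → ∀ x ∈ K, iteratedFDeriv ℝ β h x = 0)
    {ε : ℝ} (hε : 0 < ε) {δmax : ℝ} (hδmax : 0 < δmax) :
    ∃ δ : ℝ, 0 < δ ∧ δ ≤ δmax ∧ δ ≤ 1 ∧
      ∀ β, β ≤ m → ∀ x : E, ‖iteratedFDeriv ℝ β (fun y => nearCut K δ y • h y) x‖ ≤ ε := by
  -- constants
  set Cc : ℝ := ∑ i ∈ range (m + 1), nearCutBound E i with hCc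
  have hCc1 : ∀ i, i ≤ m → nearCutBound E i ≤ Cc := fun i hi =>
    single_le_sum (f := nearCutBound E) (fun i _ => zero_le_one.trans (one_le_nearCutBound i))
      (mem_range.2 (Nat.lt_succ_of_le hi))
  have hCc0 : 0 ≤ Cc := sum_nonneg fun i _ => zero_le_one.trans (one_le_nearCutBound i)
  have h8C : (0 : ℝ) ≤ 8 ^ m * Cc := mul_nonneg (by positivity) hCc0
  have hden : (0 : ℝ) < 8 ^ m * Cc + 1 := by linarith
  set η : ℝ := ε / (8 ^ m * Cc + 1) with hη
  have hη0 : 0 < η := div_pos hε hden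
  have hηε : η ≤ ε := by
    rw [hη, div_le_iff₀ hden]
    nlinarith
  have hη8 : 8 ^ m * Cc * η ≤ ε := by
    rw [hη, ← mul_div_assoc, div_le_iff₀ hden]
    nlinarith [hε.le]
  -- flat decay, uniformly in `β ≤ m`
  obtain ⟨δf, hδf0, hδf⟩ := exists_forall_le_of_antitone (P := fun β δ => ∀ x : E,
      infDist x K < δ → ‖iteratedFDeriv ℝ β h x‖ ≤ η * infDist x K ^ (m - β))
    (fun β δ δ' hle hPδ x hx => hPδ x (hx.trans_le hle))
    (fun β hβ => norm_iteratedFDeriv_le_of_flat hKc hne hh hflat β hβ η hη0)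
  set δ : ℝ := min (min δmax 1) (δf / 4) with hδ
  have hδ0 : 0 < δ := by rw [hδ]; positivity
  have hδ1 : δ ≤ 1 := (min_le_left _ _).trans (min_le_right _ _)
  have hδf4 : δ ≤ δf / 4 := min_le_right _ _
  refine ⟨δ, hδ0, (min_le_left _ _).trans (min_le_left _ _), hδ1, fun β hβ x => ?_⟩
  set Φ : E → F := fun y => nearCut K δ y • h y with hΦ
  by_cases hx1 : infDist x K < δ / 16
  · -- near `K`: `Φ = h` near `x`
    have hev : Φ =ᶠ[𝓝 x] h := by
      filter_upwards [(continuous_infDist_pt K).continuousAt.eventually (gt_mem_nhds hx1)] with y hy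
      rw [hΦ]; simp only [nearCut_eq_one hδ0 hy, one_smul]
    rw [(hev.iteratedFDeriv ℝ β).eq_of_nhds]
    have hxf : infDist x K < δf := by linarith
    refine (hδf β hβ x hxf).trans ?_
    have hd1 : infDist x K ^ (m - β) ≤ 1 := pow_le_one₀ infDist_nonneg (by linarith)
    calc η * infDist x K ^ (m - β) ≤ η * 1 := mul_le_mul_of_nonneg_left hd1 hη0.le
      _ ≤ ε := by rw [mul_one]; exact hηε
  by_cases hx2 : 2 * δ < infDist x K
  · -- far: `Φ = 0` near `x`
    have hev : Φ =ᶠ[𝓝 x] (0 : E → F) := by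
      filter_upwards [(continuous_infDist_pt K).continuousAt.eventually (lt_mem_nhds hx2)] with y hy
      show nearCut K δ y • h y = 0
      rw [nearCut_eq_zero hδ0 hy.le, zero_smul]
    rw [(hev.iteratedFDeriv ℝ β).eq_of_nhds, iteratedFDeriv_zero, Pi.zero_apply, norm_zero]
    exact hε.le
  -- transition region: `δ/16 ≤ d ≤ 2δ`
  have hd16 : δ / 16 ≤ infDist x K := not_lt.1 hx1
  have hd2 : infDist x K ≤ 2 * δ := not_lt.1 hx2
  have hpos : 0 < infDist x K := lt_of_lt_of_le (by positivity) hd16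
  have hxf : infDist x K < δf := by linarith
  have hU : IsOpen (offSet K) := isOpen_offSet K
  have h1 : ContDiffOn ℝ m (nearCut K δ) (offSet K) :=
    ((contDiff_nearCut K hδ0).of_le (by exact_mod_cast le_top)).contDiffOn
  have h2 : ContDiffOn ℝ m h (offSet K) := hh.contDiffOn
  have hleib := norm_iteratedFDerivWithin_smul_le h1 h2 hU.uniqueDiffOn hpos (n := β)
    (by exact_mod_cast hβ)
  rw [(iteratedFDerivWithin_of_isOpen β hU) hpos] at hleib
  refine hleib.trans ?_
  have h4 : (4 : ℝ) ^ m = 2 ^ (2 * m) := by rw [pow_mul]; norm_num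
  have hterm : ∀ i ∈ range (β + 1),
      (β.choose i : ℝ) * ‖iteratedFDerivWithin ℝ i (nearCut K δ) (offSet K) x‖ *
        ‖iteratedFDerivWithin ℝ (β - i) h (offSet K) x‖ ≤ (β.choose i : ℝ) * (Cc * (η * 4 ^ m)) := by
    intro i hi
    have hiβ : i ≤ β := Nat.lt_succ_iff.1 (mem_range.1 hi)
    rw [(iteratedFDerivWithin_of_isOpen i hU) hpos, (iteratedFDerivWithin_of_isOpen (β - i) hU) hpos,
      mul_assoc]
    refine mul_le_mul_of_nonneg_left ?_ (Nat.cast_nonneg (α := ℝ) _)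
    have hA := norm_iteratedFDeriv_nearCut_le K hδ0 hδ1 i x
    have hB := hδf (β - i) (by omega) x hxf
    have hexp : m - (β - i) = (m - β) + i := by omega
    rw [hexp] at hB
    -- the geometric factor
    have hgeom : infDist x K ^ (m - β + i) / δ ^ i ≤ 4 ^ m := by
      rw [div_le_iff₀ (pow_pos hδ0 i)]
      have h2pow : (2 : ℝ) ^ (m - β + i) ≤ 4 ^ m := by
        rw [h4]; exact pow_le_pow_right₀ (by norm_num) (by omega)
      have hδpow : δ ^ (m - β) ≤ 1 := pow_le_one₀ hδ0.le hδ1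
      calc infDist x K ^ (m - β + i) ≤ (2 * δ) ^ (m - β + i) :=
            pow_le_pow_left₀ infDist_nonneg hd2 _
        _ = 2 ^ (m - β + i) * (δ ^ (m - β) * δ ^ i) := by rw [mul_pow, ← pow_add]
        _ ≤ 4 ^ m * (1 * δ ^ i) :=
            mul_le_mul h2pow (mul_le_mul_of_nonneg_right hδpow (by positivity)) (by positivity)
              (by positivity)
        _ = 4 ^ m * δ ^ i := by ring
    calc ‖iteratedFDeriv ℝ i (nearCut K δ) x‖ * ‖iteratedFDeriv ℝ (β - i) h x‖
        ≤ (nearCutBound E i / δ ^ i) * (η * infDist x K ^ (m - β + i)) :=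
          mul_le_mul hA hB (norm_nonneg _)
            (div_nonneg (zero_le_one.trans (one_le_nearCutBound i)) (pow_nonneg hδ0.le i))
      _ = nearCutBound E i * η * (infDist x K ^ (m - β + i) / δ ^ i) := by ring
      _ ≤ Cc * η * 4 ^ m := mul_le_mul (mul_le_mul_of_nonneg_right (hCc1 i (hiβ.trans hβ)) hη0.le)
          hgeom (div_nonneg (pow_nonneg infDist_nonneg _) (pow_nonneg hδ0.le _))
          (mul_nonneg hCc0 hη0.le)
      _ = Cc * (η * 4 ^ m) := by ring
  refine (sum_le_sum hterm).trans ?_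
  rw [← sum_mul]
  have hchoose : ∑ i ∈ range (β + 1), (β.choose i : ℝ) = 2 ^ β := by
    exact_mod_cast Nat.sum_range_choose β
  rw [hchoose]
  have h2β : (2 : ℝ) ^ β ≤ 2 ^ m := pow_le_pow_right₀ (by norm_num) hβ
  have h8 : (8 : ℝ) ^ m = 2 ^ m * 4 ^ m := by rw [← mul_pow]; norm_num
  calc (2 : ℝ) ^ β * (Cc * (η * 4 ^ m)) ≤ 2 ^ m * (Cc * (η * 4 ^ m)) :=
        mul_le_mul_of_nonneg_right h2β (mul_nonneg hCc0 (by positivity))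
    _ = 8 ^ m * Cc * η := by rw [h8]; ring
    _ ≤ ε := hη8

variable [CompleteSpace F]

/-- **The `C^∞` extension from a compact convex body** (Whitney (1934), Thm. I, `m` infinite, on
a compact convex body, by the dilation–extrapolation operator): for `K` compact convex with
`closedBall c r ⊆ K`, `r > 0`, and `f` of class `C^∞` on `K` in the within sense, there is a
`C^∞` function on `E` equal to `f` on `K`. [cite: Whitney1934, Thm. I with §12 Lemma 2] -/
theorem exists_contDiff_extension {f : E → F} {K : Set E} {c : E} {r : ℝ} (hK : Convex ℝ K)
    (hKc : IsCompact K) (hball : closedBall c r ⊆ K) (hr : 0 < r) (hf : ContDiffOn ℝ ∞ f K) :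
    ∃ g : E → F, ContDiff ℝ ∞ g ∧ EqOn g f K := by
  have hne : K.Nonempty := ⟨c, hball (mem_closedBall_self hr.le)⟩
  have hKcl : IsClosed K := hKc.isClosed
  -- the extensions of finite order and their differences
  set g : ℕ → E → F := fun m => extOp f K c r m with hg_def
  have hg : ∀ m : ℕ, ContDiff ℝ m (g m) := fun m => contDiff_extOp hK hKc hball hr hf
  have hgK : ∀ m, EqOn (g m) f K := fun m => extOp_eqOn
  have hjet : ∀ m β, β ≤ m → ∀ x ∈ K, iteratedFDeriv ℝ β (g m) x = iteratedFDerivWithin ℝ β f K x :=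
    fun m β hβ x hx => iteratedFDeriv_extOp_eq_jet hK hKc hball hr hf hβ hx
  have hgs : ∀ m, ContDiffOn ℝ ∞ (g m) Kᶜ := fun m => contDiffOn_extOp_compl hK hKc hball hr hf
  set h : ℕ → E → F := fun m x => g (m + 1) x - g m x with hh_def
  have hh : ∀ m : ℕ, ContDiff ℝ m (h m) := fun m =>
    ((hg (m + 1)).of_le (by exact_mod_cast Nat.le_succ m)).sub (hg m)
  have hhflat : ∀ m β, β ≤ m → ∀ x ∈ K, iteratedFDeriv ℝ β (h m) x = 0 := by
    intro m β hβ x hx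
    have h1 : ContDiffAt ℝ β (g (m + 1)) x :=
      ((hg (m + 1)).of_le (by exact_mod_cast Nat.le_succ_of_le hβ)).contDiffAt
    have h2 : ContDiffAt ℝ β (g m) x := ((hg m).of_le (by exact_mod_cast hβ)).contDiffAt
    show iteratedFDeriv ℝ β (fun x => g (m + 1) x - g m x) x = 0
    rw [fun_iteratedFDeriv_sub_apply h1 h2, hjet (m + 1) β (Nat.le_succ_of_le hβ) x hx,
      hjet m β hβ x hx, sub_self]
  have hhK : ∀ m, ∀ x ∈ K, h m x = 0 := fun m x hx => by
    show g (m + 1) x - g m x = 0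
    rw [hgK (m + 1) hx, hgK m hx, sub_self]
  have hhs : ∀ m, ContDiffOn ℝ ∞ (h m) Kᶜ := fun m => (hgs (m + 1)).sub (hgs m)
  -- the cutoff scales
  have hscale : ∀ m : ℕ, ∃ δ : ℝ, 0 < δ ∧ δ ≤ 1 / (m + 1) ∧ δ ≤ 1 ∧
      ∀ β, β ≤ m → ∀ x : E, ‖iteratedFDeriv ℝ β (fun y => nearCut K δ y • h m y) x‖ ≤ (1 / 2) ^ m :=
    fun m => exists_cutoff_scale hKc hne (hh m) (hhflat m) (by positivity) (by positivity)
  choose δ hδ0 hδm hδ1 hδb using hscale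
  -- the terms
  set T : ℕ → E → F := fun m y => nearCut K (δ m) y • h m y with hT_def
  have hT_smooth : ∀ m : ℕ, ContDiff ℝ m (T m) := fun m =>
    ((contDiff_nearCut K (hδ0 m)).of_le (by exact_mod_cast le_top)).smul (hh m)
  have hT_near : ∀ m x, infDist x K < δ m / 16 → T m x = h m x := fun m x hx => by
    show nearCut K (δ m) x • h m x = h m x
    rw [nearCut_eq_one (hδ0 m) hx, one_smul]
  have hT_far : ∀ m x, 2 * δ m ≤ infDist x K → T m x = 0 := fun m x hx => by
    show nearCut K (δ m) x • h m x = 0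
    rw [nearCut_eq_zero (hδ0 m) hx, zero_smul]
  have hT_K : ∀ m, ∀ x ∈ K, T m x = 0 := fun m x hx => by
    rw [hT_near m x (by rw [infDist_zero_of_mem hx]; exact div_pos (hδ0 m) (by norm_num)), hhK m x hx]
  have hT_s : ∀ m, ContDiffOn ℝ ∞ (T m) Kᶜ := fun m =>
    (contDiff_nearCut K (hδ0 m)).contDiffOn.smul (hhs m)
  -- each point sees only finitely many terms
  have hfin : ∀ x : E, ∃ M₀ : ℕ, ∀ m, M₀ ≤ m → T m x = 0 := by
    intro x
    by_cases hx : x ∈ K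
    · exact ⟨0, fun m _ => hT_K m x hx⟩
    · have hpos : 0 < infDist x K := (hKcl.notMem_iff_infDist_pos hne).1 hx
      obtain ⟨M₀, hM₀⟩ := exists_nat_gt (2 / infDist x K)
      refine ⟨M₀, fun m hm => hT_far m x ?_⟩
      have hm1 : (2 : ℝ) / infDist x K < m + 1 := hM₀.trans_le (by exact_mod_cast Nat.le_succ_of_le hm)
      have := hδm m
      rw [div_lt_iff₀ hpos] at hm1
      calc 2 * δ m ≤ 2 * (1 / (m + 1)) := by gcongr
        _ = 2 / (m + 1) := by ring
        _ ≤ infDist x K := by rw [div_le_iff₀ (by positivity)]; linarith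
  have hsum : ∀ x, Summable fun m => T m x := fun x => by
    obtain ⟨M₀, hM₀⟩ := hfin x
    refine summable_of_ne_finset_zero (s := range M₀) fun m hm => ?_
    exact hM₀ m (not_lt.1 fun hlt => hm (mem_range.2 hlt))
  -- the extension
  set Fext : E → F := fun x => g 0 x + ∑' m, T m x with hF_def
  refine ⟨Fext, ?_, fun x hx => ?_⟩
  swap
  · -- `Fext = f` on `K`
    show g 0 x + ∑' m, T m x = f x
    rw [tsum_congr (fun m => hT_K m x hx), tsum_zero, add_zero, hgK 0 hx]
  -- `Fext` is `C^M` for every `M`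
  refine contDiff_infty.2 fun M => ?_
  -- the pieces: the vanishing-near-`K` corrections `T m - h m`, `m < M`, are `C^∞`
  have hD : ∀ m, ContDiff ℝ ∞ (fun x => T m x - h m x) := by
    intro m
    refine contDiff_iff_contDiffAt.2 fun x => ?_
    by_cases hx : infDist x K < δ m / 16
    · have hev : (fun x => T m x - h m x) =ᶠ[𝓝 x] fun _ => (0 : F) := by
        filter_upwards [(continuous_infDist_pt K).continuousAt.eventually (gt_mem_nhds hx)] with y hy
        rw [hT_near m y hy, sub_self]
      exact (contDiffAt_const (c := (0 : F))).congr_of_eventuallyEq hev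
    · have hpos : 0 < infDist x K := lt_of_lt_of_le (div_pos (hδ0 m) (by norm_num)) (not_lt.1 hx)
      have hxK : x ∈ Kᶜ := fun hxK => by rw [infDist_zero_of_mem hxK] at hpos; exact lt_irrefl _ hpos
      exact ((hT_s m).sub (hhs m)).contDiffAt (hKcl.isOpen_compl.mem_nhds hxK)
  -- the tail series is `C^M`
  have hR : ContDiff ℝ M fun x => ∑' m, T (m + M) x := by
    refine contDiff_tsum (N := M) (v := fun _ m => (1 / 2 : ℝ) ^ (m + M)) (fun m =>
      (hT_smooth (m + M)).of_le (by exact_mod_cast Nat.le_add_left M m)) (fun k _ => ?_) ?_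
    · have hgeo : Summable fun m : ℕ => (1 / 2 : ℝ) ^ m :=
        summable_geometric_of_lt_one (by norm_num) (by norm_num)
      refine (hgeo.mul_left ((1 / 2 : ℝ) ^ M)).congr fun m => ?_
      rw [pow_add, mul_comm]
    · intro k m x hk
      exact hδb (m + M) k ((show k ≤ M by exact_mod_cast hk).trans (Nat.le_add_left M m)) x
  -- the decomposition `Fext = g M + Σ_{m<M} (T m - h m) + tail`
  have hdecomp : Fext = fun x => g M x + ∑ m ∈ range M, (T m x - h m x) + ∑' m, T (m + M) x := by
    funext x
    show g 0 x + ∑' m, T m x = _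
    rw [← (hsum x).sum_add_tsum_nat_add M]
    have htel : ∑ m ∈ range M, h m x = g M x - g 0 x := by
      show ∑ m ∈ range M, (g (m + 1) x - g m x) = g M x - g 0 x
      exact sum_range_sub (fun m => g m x) M
    have hsplit : ∑ m ∈ range M, T m x = ∑ m ∈ range M, h m x + ∑ m ∈ range M, (T m x - h m x) := by
      rw [← sum_add_distrib]; exact sum_congr rfl fun m _ => by abel
    rw [hsplit, htel]
    abel
  rw [hdecomp]
  exact ((hg M).add (ContDiff.sum fun m _ => (hD m).of_le (by exact_mod_cast le_top))).add hR

end Smooth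

end Literature.Analysis.Calculus.WhitneyConvex
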